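import Literature.Barriers.AtomisticToContinuum.OneDimensionalHardCoreRodsLenard
import Literature.Barriers.AtomisticToContinuum.OneDimensionalHardCoreRodsBessel
import HarnessLib

/-!
# Hard rods, Part F″: Lenard's rod matrix is a contraction

`Literature/Barriers/AtomisticToContinuum/` (D-0021 barrier catalogue), sub-problem
`BoseEinsteinCondensation`; part of the typed proof of the rod barrier `OneDimensionalHardRods`
(`OneDimensionalHardCoreRods.lean`, eighth audit of `OneDimensionalHardCore`, 2026-08-16).

Step (4) of the paper proof: Lenard's rod matrix `A(t) = rodMatrix n L' a t`
(`OneDimensionalHardCoreRodsLenard.lean`) is the compression, to the first `n + 1` plane waves of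
the compressed ring `[0, L']`, of the operator `f ↦ σ · (f ∘ T_t) · 1_{[0,t−a] ∪ (t,L']}`, which is
a contraction (`‖Rf‖² = ∫_a^{L'} |f|² ≤ ‖f‖²`); hence `‖A(t) v‖ ≤ ‖v‖`
(`sum_norm_sq_rodMatrix_mulVec_le`), the hypothesis of the non-Hermitian adjugate bound of
`OneDimensionalHardCoreRodsAdjugate.lean`. Proof: `(A v)_k` is the `(−k)`-th plane-wave
coefficient of `H = 1_D σ (F ∘ T)`, `F = ∑_l v_l conj(e)^l`, so Bessel (`bessel_ez`) gives
`L' ∑_k |(Av)_k|² ≤ ∫|H|² = ∫_a^t |F|² + ∫_t^{L'} |F|² ≤ ∫_0^{L'}|F|² = L' ∑_l |v_l|²` (Parseval).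

## References

* [ForresterEtAl2003] P. J. Forrester et al., Phys. Rev. A 67 (2003) 043607: §2.1.2.
* [MazzantiEtAl2008] F. Mazzanti et al., Phys. Rev. Lett. 100 (2008) 020401: Eqs. (2)–(3).
-/

noncomputable section

open MeasureTheory Finset Complex Matrix
open scoped BigOperators Real ComplexConjugate

namespace Literature.Barriers.AtomisticToContinuum.BoseGas

section Contraction

variable {n : ℕ} {Lp a t : ℝ}

/-- `e(x)^k = e_k(x)`. [folklore] -/
theorem eL_pow_eq_ez (L x : ℝ) (k : ℕ) : eL L x ^ k = ez L k x := by
  have h := eL_pow_mul_conj_pow L x k 0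
  rwa [pow_zero, mul_one, Nat.cast_zero, sub_zero] at h

/-- `conj(e(x))^l = e_{−l}(x)`. [folklore] -/
theorem conj_eL_pow_eq_ez (L x : ℝ) (l : ℕ) : conj (eL L x) ^ l = ez L (-(l : ℤ)) x := by
  rw [← map_pow, eL_pow_eq_ez, conj_ez]

/-- **Parseval for plane waves indexed by an injective frequency map**:
`∫₀ᴸ |∑_i c_i e_{f i}|² = L ∑_i |c_i|²`. [folklore] -/
theorem integral_norm_sq_sum_ez_of_injective {ι : Type*} [Fintype ι] {L : ℝ} (hL : 0 < L)
    {f : ι → ℤ} (hf : Function.Injective f) (c : ι → ℂ) :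
    ∫ x in Set.Icc 0 L, ‖∑ i, c i * ez L (f i) x‖ ^ 2 = L * ∑ i, ‖c i‖ ^ 2 := by
  classical
  set g : ℝ → ℂ := fun x => ∑ i, c i * ez L (f i) x with hg
  have hpt : ∀ x, ((‖g x‖ ^ 2 : ℝ) : ℂ) =
      ∑ i, ∑ j, (c j * conj (c i)) * ez L (f j - f i) x := by
    intro x
    rw [← mul_conj_eq_norm_sq, hg]
    simp only [map_sum, map_mul, Finset.sum_mul, Finset.mul_sum]
    refine Finset.sum_congr rfl fun i _ => Finset.sum_congr rfl fun j _ => ?_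
    rw [← ez_mul_conj_ez]; ring
  have hint2 : ∀ i j : ι, IntegrableOn (fun x => (c j * conj (c i)) * ez L (f j - f i) x)
      (Set.Icc 0 L) := fun i j =>
    (continuous_const.mul (continuous_ez L _)).integrableOn_Icc
  have hC : ((∫ x in Set.Icc 0 L, ‖g x‖ ^ 2 : ℝ) : ℂ) = ((L * ∑ i, ‖c i‖ ^ 2 : ℝ) : ℂ) := by
    rw [← integral_complex_ofReal]
    simp_rw [hpt]
    rw [integral_finsetSum _ fun i _ => integrable_finsetSum _ fun j _ => hint2 i j]
    simp_rw [integral_finsetSum _ fun j _ => hint2 _ j, integral_const_mul,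
      integral_ez_Icc hL, sub_eq_zero, hf.eq_iff, mul_ite, mul_zero]
    simp_rw [Finset.sum_ite_eq', Finset.mem_univ, if_true]
    push_cast
    rw [Finset.mul_sum]
    refine Finset.sum_congr rfl fun i _ => ?_
    rw [mul_conj_eq_norm_sq]; push_cast; ring
  exact_mod_cast hC

/-- The trigonometric polynomial `F(y) = ∑_l v_l conj(e(y))^l` paired with the rod matrix.
[folklore] -/
def rodPoly (n : ℕ) (Lp : ℝ) (v : Fin (n + 1) → ℂ) (y : ℝ) : ℂ :=
  ∑ l : Fin (n + 1), v l * conj (eL Lp y) ^ (l : ℕ)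

/-- `F` is continuous. [folklore] -/
theorem continuous_rodPoly (n : ℕ) (Lp : ℝ) (v : Fin (n + 1) → ℂ) : Continuous (rodPoly n Lp v) := by
  unfold rodPoly
  refine continuous_finsetSum _ fun l _ => continuous_const.mul ?_
  exact (Complex.continuous_conj.comp (continuous_eL Lp)).pow _

/-- `|F(y)| ≤ ∑_l |v_l|`. [folklore] -/
theorem norm_rodPoly_le (n : ℕ) (Lp : ℝ) (v : Fin (n + 1) → ℂ) (y : ℝ) :
    ‖rodPoly n Lp v y‖ ≤ ∑ l : Fin (n + 1), ‖v l‖ := by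
  unfold rodPoly
  refine (norm_sum_le _ _).trans (Finset.sum_le_sum fun l _ => ?_)
  rw [norm_mul, norm_pow, Complex.norm_conj, norm_eL, one_pow, mul_one]

/-- Parseval for `F`: `∫₀^{L'} |F|² = L' ∑_l |v_l|²`. [folklore] -/
theorem integral_norm_sq_rodPoly (hLp : 0 < Lp) (v : Fin (n + 1) → ℂ) :
    ∫ y in Set.Icc 0 Lp, ‖rodPoly n Lp v y‖ ^ 2 = Lp * ∑ l : Fin (n + 1), ‖v l‖ ^ 2 := by
  have hF : ∀ y, rodPoly n Lp v y = ∑ l : Fin (n + 1), v l * ez Lp (-((l : ℕ) : ℤ)) y := by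
    intro y
    unfold rodPoly
    refine Finset.sum_congr rfl fun l _ => ?_
    rw [conj_eL_pow_eq_ez]
  simp_rw [hF]
  refine integral_norm_sq_sum_ez_of_injective hLp (f := fun l : Fin (n + 1) => -((l : ℕ) : ℤ))
    ?_ v
  intro l l' h
  simp only [neg_inj, Nat.cast_inj] at h
  exact Fin.ext h

/-- The function whose plane-wave coefficients are the entries of `A(t) v`:
`H = 1_D · σ · (F ∘ T_t)`. [folklore] -/
def rodTestFun (n : ℕ) (Lp a t : ℝ) (v : Fin (n + 1) → ℂ) (x : ℝ) : ℂ :=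
  (rodDomain Lp a t).indicator (fun x => rodWeight n Lp a t x * rodPoly n Lp v (rodShift a t x)) x

/-- The compressed domain is measurable. [folklore] -/
theorem measurableSet_rodDomain (Lp a t : ℝ) : MeasurableSet (rodDomain Lp a t) :=
  measurableSet_Icc.union measurableSet_Ioc

/-- `H` is measurable. [folklore] -/
theorem measurable_rodTestFun (n : ℕ) (Lp a t : ℝ) (v : Fin (n + 1) → ℂ) :
    Measurable (rodTestFun n Lp a t v) := by
  unfold rodTestFun
  refine Measurable.indicator ?_ (measurableSet_rodDomain Lp a t)
  exact (measurable_rodWeight n Lp a t).mul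
    ((continuous_rodPoly n Lp v).measurable.comp (measurable_rodShift a t))

/-- `|H| ≤ ∑_l |v_l|`. [folklore] -/
theorem norm_rodTestFun_le (n : ℕ) (Lp a t : ℝ) (v : Fin (n + 1) → ℂ) (x : ℝ) :
    ‖rodTestFun n Lp a t v x‖ ≤ ∑ l : Fin (n + 1), ‖v l‖ := by
  unfold rodTestFun
  refine le_trans (norm_indicator_le_norm_self _ x) ?_
  rw [norm_mul]
  calc ‖rodWeight n Lp a t x‖ * ‖rodPoly n Lp v (rodShift a t x)‖
      ≤ 1 * ∑ l : Fin (n + 1), ‖v l‖ :=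
        mul_le_mul (norm_rodWeight_le n Lp a t x) (norm_rodPoly_le n Lp v _) (norm_nonneg _)
          zero_le_one
    _ = ∑ l : Fin (n + 1), ‖v l‖ := one_mul _

/-- The compressed domain lies in `[0, L']`. [folklore] -/
theorem rodDomain_subset_Icc (ht0 : 0 ≤ t) (htL : t ≤ Lp) (ha : 0 ≤ a) :
    rodDomain Lp a t ⊆ Set.Icc 0 Lp := by
  intro x hx
  rcases hx with hx | hx
  · exact ⟨hx.1, by linarith [hx.2]⟩
  · exact ⟨by linarith [hx.1], hx.2⟩

/-- **The entries of `A(t) v` are plane-wave coefficients of `H`**: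
`(A v)_k = Ĥ(−k)`. [folklore] -/
theorem rodMatrix_mulVec_eq_ezCoeff (hLp : 0 < Lp) (ha : 0 ≤ a) (hat : a ≤ t) (htL : t ≤ Lp)
    (v : Fin (n + 1) → ℂ) (k : Fin (n + 1)) :
    (rodMatrix n Lp a t *ᵥ v) k = ezCoeff Lp (rodTestFun n Lp a t v) (-((k : ℕ) : ℤ)) := by
  have ht0 : 0 ≤ t := ha.trans hat
  have hG := gramShift_rod_eq_smul (n := n) hLp ha hat htL
  have hentry : ∀ l : Fin (n + 1), rodMatrix n Lp a t k l = (Lp : ℂ)⁻¹ *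
      ∫ x in rodDomain Lp a t, rodWeight n Lp a t x * eL Lp x ^ (k : ℕ) *
        conj (eL Lp (rodShift a t x)) ^ (l : ℕ) := by
    intro l
    have h := congr_fun (congr_fun hG k) l
    simp only [gramShift, of_apply, Matrix.smul_apply, smul_eq_mul] at h
    rw [h, ← mul_assoc, inv_mul_cancel₀ (by exact_mod_cast hLp.ne'), one_mul]
  -- integrability of the one-body integrands on the compressed domain
  have hint : ∀ l : Fin (n + 1), Integrable (fun x => rodWeight n Lp a t x * eL Lp x ^ (k : ℕ) *
      conj (eL Lp (rodShift a t x)) ^ (l : ℕ)) (volume.restrict (rodDomain Lp a t)) := fun l =>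
    integrable_weight_pow_pow _ Lp (measurable_rodWeight n Lp a t) (norm_rodWeight_le n Lp a t)
      (measurable_rodShift a t) _ _
  simp only [mulVec, dotProduct, hentry]
  rw [ezCoeff]
  simp_rw [mul_assoc ((Lp : ℂ)⁻¹), ← Finset.mul_sum]
  congr 1
  calc ∑ l : Fin (n + 1), (∫ x in rodDomain Lp a t, rodWeight n Lp a t x * eL Lp x ^ (k : ℕ) *
          conj (eL Lp (rodShift a t x)) ^ (l : ℕ)) * v l
      = ∫ x in rodDomain Lp a t, ∑ l : Fin (n + 1), (rodWeight n Lp a t x * eL Lp x ^ (k : ℕ) *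
          conj (eL Lp (rodShift a t x)) ^ (l : ℕ)) * v l := by
        rw [integral_finsetSum _ fun l _ => (hint l).mul_const _]
        refine Finset.sum_congr rfl fun l _ => ?_
        rw [integral_mul_const]
    _ = ∫ x in rodDomain Lp a t, eL Lp x ^ (k : ℕ) *
          (rodWeight n Lp a t x * rodPoly n Lp v (rodShift a t x)) := by
        refine integral_congr_ae (Filter.Eventually.of_forall fun x => ?_)
        simp only [rodPoly, Finset.mul_sum]
        refine Finset.sum_congr rfl fun l _ => ?_
        ring
    _ = ∫ x in Set.Icc 0 Lp, (rodDomain Lp a t).indicator (fun x => eL Lp x ^ (k : ℕ) *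
          (rodWeight n Lp a t x * rodPoly n Lp v (rodShift a t x))) x := by
        rw [setIntegral_indicator (measurableSet_rodDomain Lp a t),
          Set.inter_eq_self_of_subset_right (rodDomain_subset_Icc ht0 htL ha)]
    _ = ∫ x in Set.Icc 0 Lp, conj (ez Lp (-((k : ℕ) : ℤ)) x) * rodTestFun n Lp a t v x := by
        refine integral_congr_ae (Filter.Eventually.of_forall fun x => ?_)
        simp only [rodTestFun]
        rw [conj_ez, neg_neg, ← eL_pow_eq_ez]
        by_cases hx : x ∈ rodDomain Lp a t
        · rw [Set.indicator_of_mem hx, Set.indicator_of_mem hx]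
        · rw [Set.indicator_of_notMem hx, Set.indicator_of_notMem hx, mul_zero]

/-- `∫₀^{L'} |H|² = ∫_{[0,t−a]} |F(x+a)|² + ∫_{(t,L']} |F|²`. [folklore] -/
theorem integral_norm_sq_rodTestFun (ha : 0 ≤ a) (hat : a ≤ t) (htL : t ≤ Lp)
    (v : Fin (n + 1) → ℂ) :
    ∫ x in Set.Icc 0 Lp, ‖rodTestFun n Lp a t v x‖ ^ 2 =
      (∫ x in Set.Icc 0 (t - a), ‖rodPoly n Lp v (x + a)‖ ^ 2) +
        ∫ x in Set.Ioc t Lp, ‖rodPoly n Lp v x‖ ^ 2 := by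
  have ht0 : 0 ≤ t := ha.trans hat
  set F := rodPoly n Lp v with hFdef
  have hFc : Continuous F := continuous_rodPoly n Lp v
  have hpt : ∀ x, ‖rodTestFun n Lp a t v x‖ ^ 2 =
      (rodDomain Lp a t).indicator (fun x => ‖F (rodShift a t x)‖ ^ 2) x := by
    intro x
    simp only [rodTestFun]
    by_cases hx : x ∈ rodDomain Lp a t
    · rw [Set.indicator_of_mem hx, Set.indicator_of_mem hx, norm_mul]
      have h1 : ‖rodWeight n Lp a t x‖ = 1 := by
        unfold rodWeight; split_ifs
        · rw [norm_neg, norm_exp_ofReal_mul_I]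
        · rw [norm_one]
      rw [h1, one_mul]
    · rw [Set.indicator_of_notMem hx, Set.indicator_of_notMem hx, norm_zero]
      ring
  simp_rw [hpt]
  rw [setIntegral_indicator (measurableSet_rodDomain Lp a t),
    Set.inter_eq_self_of_subset_right (rodDomain_subset_Icc ht0 htL ha)]
  unfold rodDomain
  have hI1 : IntegrableOn (fun x => ‖F (rodShift a t x)‖ ^ 2) (Set.Icc 0 (t - a)) :=
    Integrable.mono' (integrable_const ((∑ l : Fin (n + 1), ‖v l‖) ^ 2))
      ((hFc.measurable.comp (measurable_rodShift a t)).norm.pow_const 2).aestronglyMeasurable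
      (Filter.Eventually.of_forall fun x => by
        rw [Real.norm_eq_abs, abs_of_nonneg (sq_nonneg _)]
        exact pow_le_pow_left₀ (norm_nonneg _) (norm_rodPoly_le n Lp v _) 2)
  have hI2 : IntegrableOn (fun x => ‖F (rodShift a t x)‖ ^ 2) (Set.Ioc t Lp) :=
    Integrable.mono' (integrable_const ((∑ l : Fin (n + 1), ‖v l‖) ^ 2))
      ((hFc.measurable.comp (measurable_rodShift a t)).norm.pow_const 2).aestronglyMeasurable
      (Filter.Eventually.of_forall fun x => by
        rw [Real.norm_eq_abs, abs_of_nonneg (sq_nonneg _)]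
        exact pow_le_pow_left₀ (norm_nonneg _) (norm_rodPoly_le n Lp v _) 2)
  rw [setIntegral_union (disjoint_rodDomain ha t) measurableSet_Ioc hI1 hI2]
  congr 1
  · refine setIntegral_congr_fun measurableSet_Icc fun x hx => ?_
    simp only [rodShift, if_pos hx.2]
  · refine setIntegral_congr_fun measurableSet_Ioc fun x hx => ?_
    have hgt : ¬ x ≤ t - a := not_le.mpr (by linarith [hx.1])
    simp only [rodShift, if_neg hgt]

/-- `∫_{[0,t−a]} |F(x+a)|² + ∫_{(t,L']} |F|² ≤ ∫₀^{L'} |F|²` (translate the first piece to `[a, t]`;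
the union `[a, t] ∪ (t, L']` is `[a, L'] ⊆ [0, L']`). [folklore] -/
theorem integral_norm_sq_rodTestFun_le (hLp : 0 < Lp) (ha : 0 ≤ a) (hat : a ≤ t) (htL : t ≤ Lp)
    (v : Fin (n + 1) → ℂ) :
    ∫ x in Set.Icc 0 Lp, ‖rodTestFun n Lp a t v x‖ ^ 2 ≤
      ∫ x in Set.Icc 0 Lp, ‖rodPoly n Lp v x‖ ^ 2 := by
  have ht0 : 0 ≤ t := ha.trans hat
  set F := rodPoly n Lp v with hFdef
  set G : ℝ → ℝ := fun x => ‖F x‖ ^ 2 with hGdef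
  have hGc : Continuous G := (continuous_rodPoly n Lp v).norm.pow 2
  have hii : ∀ u w : ℝ, IntervalIntegrable G volume u w := fun u w => hGc.intervalIntegrable u w
  rw [integral_norm_sq_rodTestFun ha hat htL]
  -- the three pieces as interval integrals
  have h1 : ∫ x in Set.Icc 0 (t - a), ‖F (x + a)‖ ^ 2 = ∫ x in a..t, G x := by
    rw [integral_Icc_eq_integral_Ioc, ← intervalIntegral.integral_of_le (sub_nonneg.mpr hat),
      show (fun x => ‖F (x + a)‖ ^ 2) = fun x => G (x + a) from rfl,
      intervalIntegral.integral_comp_add_right G a, zero_add, sub_add_cancel]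
  have h2 : ∫ x in Set.Ioc t Lp, ‖F x‖ ^ 2 = ∫ x in t..Lp, G x := by
    rw [← intervalIntegral.integral_of_le htL]
  have h3 : ∫ x in Set.Icc 0 Lp, ‖F x‖ ^ 2 = ∫ x in (0 : ℝ)..Lp, G x := by
    rw [integral_Icc_eq_integral_Ioc, ← intervalIntegral.integral_of_le hLp.le]
  rw [h1, h2, h3, intervalIntegral.integral_add_adjacent_intervals (hii a t) (hii t Lp),
    ← intervalIntegral.integral_add_adjacent_intervals (hii 0 a) (hii a Lp)]
  have h0a : 0 ≤ ∫ x in (0 : ℝ)..a, G x :=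
    intervalIntegral.integral_nonneg ha fun u _ => sq_nonneg _
  linarith

/-- **Lenard's rod matrix is a contraction**: `‖A(t) v‖ ≤ ‖v‖` for `0 ≤ a ≤ t ≤ L'`.
(Step (4) of the paper proof: `A(t)` is the compression of `f ↦ σ(f∘T_t)1_D`, and
`‖σ(f∘T_t)1_D‖² = ∫_a^{L'}|f|²`.) [folklore] -/
theorem sum_norm_sq_rodMatrix_mulVec_le (hLp : 0 < Lp) (ha : 0 ≤ a) (hat : a ≤ t) (htL : t ≤ Lp)
    (v : Fin (n + 1) → ℂ) :
    ∑ k : Fin (n + 1), ‖(rodMatrix n Lp a t *ᵥ v) k‖ ^ 2 ≤ ∑ k : Fin (n + 1), ‖v k‖ ^ 2 := by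
  set H := rodTestFun n Lp a t v with hH
  set f : Fin (n + 1) → ℤ := fun k => -((k : ℕ) : ℤ) with hf
  have hfinj : Function.Injective f := by
    intro k k' h
    simp only [hf, neg_inj, Nat.cast_inj] at h
    exact Fin.ext h
  -- `∑_k |(Av)_k|² = ∑_{m ∈ image} |Ĥ(m)|²`
  have hsum : ∑ k : Fin (n + 1), ‖(rodMatrix n Lp a t *ᵥ v) k‖ ^ 2 =
      ∑ m ∈ Finset.univ.image f, ‖ezCoeff Lp H m‖ ^ 2 := by
    rw [Finset.sum_image fun k _ k' _ h => hfinj h]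
    refine Finset.sum_congr rfl fun k _ => ?_
    rw [rodMatrix_mulVec_eq_ezCoeff hLp ha hat htL v k]
  -- Bessel and Parseval
  have hB := bessel_ez hLp (measurable_rodTestFun n Lp a t v) (norm_rodTestFun_le n Lp a t v)
    (Finset.univ.image f)
  have hle := integral_norm_sq_rodTestFun_le (n := n) hLp ha hat htL v
  rw [integral_norm_sq_rodPoly hLp v] at hle
  rw [hsum]
  have hchain : Lp * ∑ m ∈ Finset.univ.image f, ‖ezCoeff Lp H m‖ ^ 2 ≤
      Lp * ∑ l : Fin (n + 1), ‖v l‖ ^ 2 := hB.trans hle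
  exact le_of_mul_le_mul_left hchain hLp

end Contraction

end Literature.Barriers.AtomisticToContinuum.BoseGas

end
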